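import Mathlib

/-!
# The universal layer profile `F(m) = exp (-K m³ / (6 h P))` (solo-blind, PLATEAU, paper §24.93(20)(i))

In the ideal chain the slowly varying envelopes of the slow eigenvector obey, at first WKB order,
the two-step recursion `g(m+1) - g(m-1) = -(K₀ m² / (|h| P)) g(m)`, whose continuum form is
`2 g' = -(K₀ m² / (|h| P)) g`, solved by `F(m) = exp (-K₀ m³ / (6 |h| P))` — the profile onto which
all measured envelopes collapse (layer scale `m_L = (|h| P / K₀)^{1/3}`).  This file records the
calculus fact: `F' = -(K m² / (2 h P)) F`, i.e. `2 F' = -(K m²/(h P)) F`, for all real parameters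
(Lean's `x / 0 = 0` makes the degenerate case consistent, so no hypothesis is needed), and the
scaling form `F(m) = exp (-(m/m_L)^3/6)` when `m_L^3 = h P / K`.
-/

namespace Summit.AnomalousDissipation.AnomalousDissipation.Theorems

/-- The layer profile. -/
noncomputable def layerProfile (K h P : ℝ) (x : ℝ) : ℝ := Real.exp (-(K * x ^ 3 / (6 * h * P)))

/-- `F' (m) = -(K m²/(2 h P)) · F(m)`. -/
theorem layerProfile_hasDerivAt (K h P m : ℝ) :
    HasDerivAt (layerProfile K h P) (-(K * m ^ 2 / (2 * h * P)) * layerProfile K h P m) m := by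
  unfold layerProfile
  have h1 : HasDerivAt (fun x : ℝ => K * x ^ 3 / (6 * h * P)) (K * (3 * m ^ 2) / (6 * h * P)) m := by
    have := ((hasDerivAt_pow 3 m).const_mul K).div_const (6 * h * P)
    simpa using this
  have h2 : HasDerivAt (fun x : ℝ => Real.exp (-(K * x ^ 3 / (6 * h * P))))
      (Real.exp (-(K * m ^ 3 / (6 * h * P))) * (-(K * (3 * m ^ 2) / (6 * h * P)))) m := (h1.neg).exp
  have h3 : -(K * (3 * m ^ 2) / (6 * h * P)) = -(K * m ^ 2 / (2 * h * P)) := by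
    by_cases hhP : h * P = 0
    · have e6 : 6 * h * P = 0 := by rw [mul_assoc, hhP, mul_zero]
      have e2 : 2 * h * P = 0 := by rw [mul_assoc, hhP, mul_zero]
      simp [e6, e2]
    · have e6 : 6 * h * P ≠ 0 := by rw [mul_assoc]; exact mul_ne_zero (by norm_num) hhP
      have e2 : 2 * h * P ≠ 0 := by rw [mul_assoc]; exact mul_ne_zero two_ne_zero hhP
      field_simp
      try ring
  exact h2.congr_deriv (by rw [h3]; ring)

/-- First-order WKB form: `2 F'(m) = -(K m² / (h P)) F(m)`. -/
theorem layerProfile_wkb (K h P m : ℝ) :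
    2 * deriv (layerProfile K h P) m = -(K * m ^ 2 / (h * P)) * layerProfile K h P m := by
  rw [(layerProfile_hasDerivAt K h P m).deriv]
  by_cases hhP : h * P = 0
  · have : 2 * h * P = 0 := by rw [mul_assoc, hhP, mul_zero]
    simp [this, hhP]
  · have h2 : 2 * h * P ≠ 0 := by rw [mul_assoc]; exact mul_ne_zero two_ne_zero hhP
    field_simp
    try ring

/-- Scaling form: if `mL ^ 3 = h * P / K` with `K ≠ 0` and `mL ≠ 0` then `F(m) = exp (-(m/mL)^3/6)`. -/
theorem layerProfile_scaling (K h P mL m : ℝ) (hK : K ≠ 0) (hmL : mL ≠ 0)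
    (hscale : mL ^ 3 = h * P / K) :
    layerProfile K h P m = Real.exp (-((m / mL) ^ 3 / 6)) := by
  unfold layerProfile
  congr 1
  have hhP : h * P = K * mL ^ 3 := by
    rw [hscale]; field_simp
  have : 6 * h * P = 6 * (K * mL ^ 3) := by rw [mul_assoc, hhP]
  rw [this, div_pow]
  have hmL3 : mL ^ 3 ≠ 0 := pow_ne_zero 3 hmL
  field_simp
  try ring

/-- `F(0) = 1` and `0 < F`. -/
theorem layerProfile_zero_pos (K h P m : ℝ) : layerProfile K h P 0 = 1 ∧ 0 < layerProfile K h P m := by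
  unfold layerProfile
  exact ⟨by simp, Real.exp_pos _⟩

end Summit.AnomalousDissipation.AnomalousDissipation.Theorems
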